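import Mathlib
import Summits.MatrixMultiplication.MatrixMultiplication.Theses.ThinBlockAlpha
import Summits.MatrixMultiplication.MatrixMultiplication.Theorems.ThinPackings.Negative.TriageRuledGraphPatternedArc
import Summits.MatrixMultiplication.MatrixMultiplication.Theorems.ThinBlockAlphaThinPackingsStubDeborderingPower
import Summits.MatrixMultiplication.MatrixMultiplication.Theorems.ThinBlockAlphaThinPackingsStubBoxFreiman
import Summits.MatrixMultiplication.MatrixMultiplication.Theorems.ThinBlockAlphaThinPackingsStubGradedFrames
import Summits.MatrixMultiplication.MatrixMultiplication.Theorems.ThinBlockAlphaThinPackingsStubGeneralBridge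

set_option linter.dupNamespace false

/-!
# `ThinPackings` (crux stmt-MatrixMultiplication-10595, route `ThinBlockAlpha`) — the de-bordering reductions
of line `label-weighted-stpp-debordering`, as closed theorems

Two sorry-free REDUCTIONS to the crux `Summit.…Theses.ThinBlockAlpha.ThinPackings` (helpers `--supports`;
neither closes the crux):

* `thinPackings_of_weightedThinPackings` — **the de-bordering principle**: it suffices to build, for every
  shape exponent `a < 1` and slack `η > 0`, a two-leg-tight thin family that is only LABEL-WEIGHTED STPP
  (`Triage2.IsLabelWeightedSTPP A B C κ μ`: the three packings and the TPP of each block are hard, a cross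
  relation with labels `(i, j, k)` not all equal is admissible iff its weight `(κ i − κ k) + (μ j − μ k) ≥ 1`)
  with integer potentials bounded by any `R`, in ANY finite abelian group.  Proof: take such a family at slack
  `η/2`, pass to the `n`-th power `Fin n → H` and keep the most popular weight-sum class
  (`stub_deborderingPower`, landed: an honest `IsSTPP` family of `L' ≥ Lⁿ/(2nR+1)²` blocks `⟨Nⁿ, Mⁿ, Nⁿ⟩`),
  with `n` chosen so that `(2nR+1)² ≤ N^{nη/2}` (exponentials beat squares).
* `thinPackings_of_multiRadiusFrameDesigns` — **the line's composition**: the registered design statement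
  `stub_multiRadiusFrames` (multi-radius orthogonal frames on graded spheres in boxes `[-b, b]^D`, residual
  clauses, two-leg tight against the host `(ℤ/(6b+1))^D`) implies the crux, via `stub_gradedFrames` (graded
  frames are label-weighted with potentials `κ = μ = −d`), `stub_boxFreiman` (reduction mod `6b+1 > 6b`
  preserves the weighted family and the cardinalities) and the de-bordering principle.  This is the skeleton
  theorem `ThinPackings_of` of `Cruxes/ThinPackings/Lines/label-weighted-stpp-debordering.lean` with its one
  open stub turned into an explicit hypothesis, so that the promoted design statement closes the crux by modus
  ponens the day it is proved.
* `thinPackings_of_generalFrameDesigns` — the same for the lead's reshape v3 (`stub_generalFrameDesigns`: ARBITRARY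
  per-block radii and ORDER-COMPATIBLE potentials, via `stub_generalBridge`), the weakest design statement the
  Pythagoras method supports; it is the statement handed to the planners by `promote-stub`.

Lead prover-line-stmt-MatrixMultiplication-10595-0, 2026-08-16.
-/

namespace Summit.MatrixMultiplication.MatrixMultiplication.Theorems.ThinPackings

open Finset Filter
open Literature.Computability.AlgebraicComplexity (IsSTPP)
open Summit.MatrixMultiplication.MatrixMultiplication.Theses.ThinBlockAlpha (ThinPackings)
open Summit.MatrixMultiplication.MatrixMultiplication.Theorems.ThinPackings.Negative.Triage2 (IsLabelWeightedSTPP)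

/-- Exponentials beat squares: for `r > 1` and any `K` some `n ≥ 1` has `K·n² ≤ rⁿ`. [folklore] -/
theorem exists_one_le_mul_sq_le_pow {r : ℝ} (hr : 1 < r) (K : ℝ) :
    ∃ n : ℕ, 1 ≤ n ∧ K * (n : ℝ) ^ 2 ≤ r ^ n := by
  by_cases hK : K ≤ 0
  · refine ⟨1, le_rfl, ?_⟩
    have : K * ((1 : ℕ) : ℝ) ^ 2 ≤ 0 := by
      simp only [Nat.cast_one, one_pow, mul_one]; exact hK
    exact this.trans (by positivity)
  · have hK : 0 < K := lt_of_not_ge hK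
    have hlim := tendsto_pow_const_div_const_pow_of_one_lt 2 hr
    have hε : (0 : ℝ) < 1 / K := by positivity
    obtain ⟨n, hn, hn1⟩ := ((hlim.eventually (gt_mem_nhds hε)).and (eventually_ge_atTop 1)).exists
    refine ⟨n, hn1, ?_⟩
    have hrn : (0 : ℝ) < r ^ n := pow_pos (by linarith) n
    have h1 : (n : ℝ) ^ 2 < 1 / K * r ^ n := (div_lt_iff₀ hrn).1 hn
    have h2 : K * (n : ℝ) ^ 2 < K * (1 / K * r ^ n) := mul_lt_mul_of_pos_left h1 hK
    have h3 : K * (1 / K * r ^ n) = r ^ n := by field_simp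
    linarith

/-- **The de-bordering principle** (`WeightedThinPackings → ThinPackings`): two-leg-tight thin
LABEL-WEIGHTED STPP families with bounded integer potentials, for all `a < 1`, `η > 0`, in arbitrary finite
abelian groups, already give the crux `ThinPackings`.  Take the weighted family at slack `η/2`, tensor it up
`n` times with `(2nR+1)² ≤ N^{nη/2}` and keep the popular weight-sum class (`stub_deborderingPower`).
[new; the STPP mirror of Blasiak–Church–Cohn–Grochow–Naslund–Sawin–Umans 2017, Lemma 3.4] -/
theorem thinPackings_of_weightedThinPackings
    (hW : ∀ a : ℝ, 0 ≤ a → a < 1 → ∀ η : ℝ, 0 < η → ∃ (H : Type) (_ : AddCommGroup H) (_ : Fintype H)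
      (L N M R : ℕ) (A B C : Fin L → Finset H) (κ μ : Fin L → ℤ), IsLabelWeightedSTPP A B C κ μ ∧
      (∀ i, (A i).card = N ∧ (B i).card = M ∧ (C i).card = N) ∧ 2 ≤ N ∧ (N : ℝ) ^ a ≤ M ∧
      (∀ i, |κ i| ≤ R ∧ |μ i| ≤ R) ∧ (Fintype.card H : ℝ) ≤ L * (N : ℝ) ^ (2 + η)) :
    ThinPackings := by
  intro a ha0 ha1 η hη
  obtain ⟨H, hH1, hH2, L, N, M, R, A, B, C, κ, μ, hLW, hc, hN, hM, hR, hH⟩ :=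
    hW a ha0 ha1 (η / 2) (by positivity)
  have hN1 : (1 : ℝ) < N := by exact_mod_cast (by omega : 1 < N)
  have hNpos : (0 : ℝ) < N := by linarith
  have hN0 : (0 : ℝ) ≤ N := hNpos.le
  -- choose the tensor power
  set r : ℝ := (N : ℝ) ^ (η / 2) with hr
  have hr1 : 1 < r := Real.one_lt_rpow hN1 (by positivity)
  obtain ⟨n, hn1, hn⟩ := exists_one_le_mul_sq_le_pow hr1 (((2 * R + 1 : ℕ) : ℝ) ^ 2)
  obtain ⟨L', A', B', C', hS, hc', hL'⟩ := stub_deborderingPower H L N M R A B C κ μ hLW hc hR n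
  refine ⟨Fin n → H, inferInstance, inferInstance, L', N ^ n, M ^ n, A', B', C', hS, hc', ?_, ?_, ?_⟩
  · -- 2 ≤ N ^ n
    calc 2 ≤ N := hN
      _ = N ^ 1 := (pow_one N).symm
      _ ≤ N ^ n := Nat.pow_le_pow_right (by omega) hn1
  · -- (N^n)^a ≤ M^n
    have h0 : (0 : ℝ) ≤ (N : ℝ) ^ a := by positivity
    push_cast
    rw [← Real.rpow_natCast_mul hN0, mul_comm, Real.rpow_mul_natCast hN0]
    exact pow_le_pow_left₀ h0 hM n
  · -- the packing count
    have hcardH : (0 : ℝ) ≤ Fintype.card H := Nat.cast_nonneg _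
    have hL'R : ((L : ℝ)) ^ n ≤ (L' : ℝ) * ((2 * n * R + 1 : ℕ) : ℝ) ^ 2 := by exact_mod_cast hL'
    -- (2nR+1)^2 ≤ (2R+1)^2 n^2 ≤ r^n
    have hsq : (((2 * n * R + 1 : ℕ) : ℝ)) ^ 2 ≤ r ^ n := by
      have h1 : ((2 * n * R + 1 : ℕ) : ℝ) ≤ ((2 * R + 1 : ℕ) : ℝ) * n := by
        have : 2 * n * R + 1 ≤ (2 * R + 1) * n := by nlinarith
        exact_mod_cast this
      have h2 : (0 : ℝ) ≤ ((2 * n * R + 1 : ℕ) : ℝ) := Nat.cast_nonneg _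
      calc (((2 * n * R + 1 : ℕ) : ℝ)) ^ 2 ≤ (((2 * R + 1 : ℕ) : ℝ) * n) ^ 2 :=
            pow_le_pow_left₀ h2 h1 2
        _ = ((2 * R + 1 : ℕ) : ℝ) ^ 2 * (n : ℝ) ^ 2 := by ring
        _ ≤ r ^ n := hn
    have hL'0 : (0 : ℝ) ≤ L' := Nat.cast_nonneg _
    -- exponent identities
    have hsplit : r * (N : ℝ) ^ (2 + η / 2) = (N : ℝ) ^ (2 + η) := by
      rw [hr, ← Real.rpow_add hNpos]; ring_nf
    have hpow : ((N : ℝ) ^ (2 + η)) ^ n = (((N ^ n : ℕ) : ℝ)) ^ (2 + η) := by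
      push_cast
      rw [← Real.rpow_mul_natCast hN0, mul_comm, Real.rpow_natCast_mul hN0]
    rw [Fintype.card_fun, Fintype.card_fin]
    push_cast
    calc ((Fintype.card H : ℝ)) ^ n ≤ ((L : ℝ) * (N : ℝ) ^ (2 + η / 2)) ^ n :=
          pow_le_pow_left₀ hcardH hH n
      _ = (L : ℝ) ^ n * ((N : ℝ) ^ (2 + η / 2)) ^ n := mul_pow _ _ _
      _ ≤ ((L' : ℝ) * ((2 * n * R + 1 : ℕ) : ℝ) ^ 2) * ((N : ℝ) ^ (2 + η / 2)) ^ n := by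
          gcongr
      _ ≤ ((L' : ℝ) * r ^ n) * ((N : ℝ) ^ (2 + η / 2)) ^ n := by
          gcongr
      _ = (L' : ℝ) * ((r * (N : ℝ) ^ (2 + η / 2)) ^ n) := by rw [mul_pow]; ring
      _ = (L' : ℝ) * (((N : ℝ) ^ n)) ^ (2 + η) := by
          rw [hsplit, hpow]; push_cast; rfl

/-- **The line's composition** (`MultiRadiusFrameDesigns → ThinPackings`): the registered design statement
`stub_multiRadiusFrames` of line `label-weighted-stpp-debordering` — for every `a < 1`, `η > 0`, orthogonal
frames `A B C : Fin L → Finset (Fin D → ℤ)` on graded spheres (squared radii `xA + α·d i`, `xB − β·d i`,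
`xC + γ·d i`, admissible slopes `0 ≤ α, γ`, `1 ≤ α + γ`, `α, γ < β`) in the box `[-b, b]^D`, blocks
`⟨N, M, N⟩` with `N ≥ 2`, `N^a ≤ M`, the three packings and the non-convex distinct clause, grades in
`[-R, R]`, and `(6b+1)^D ≤ L·N^{2+η}` — implies the crux: graded frames are label-weighted with potentials
`−d` (`stub_gradedFrames`), reduction mod `6b+1` keeps that (`stub_boxFreiman`) with host
`|(ℤ/(6b+1))^D| = (6b+1)^D`, and the de-bordering principle finishes. [new] -/
theorem thinPackings_of_multiRadiusFrameDesigns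
    (hF : ∀ a : ℝ, 0 ≤ a → a < 1 → ∀ η : ℝ, 0 < η →
      ∃ (D L N M b R : ℕ) (A B C : Fin L → Finset (Fin D → ℤ)) (d : Fin L → ℤ) (xA xB xC α β γ : ℤ),
        (0 ≤ α ∧ 0 ≤ γ ∧ 1 ≤ α + γ ∧ α < β ∧ γ < β) ∧
        ((∀ i, ∀ x ∈ A i, ∀ y ∈ B i, x ⬝ᵥ y = 0) ∧ (∀ i, ∀ x ∈ A i, ∀ z ∈ C i, x ⬝ᵥ z = 0) ∧
          (∀ i, ∀ y ∈ B i, ∀ z ∈ C i, y ⬝ᵥ z = 0)) ∧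
        ((∀ i, ∀ x ∈ A i, x ⬝ᵥ x = xA + α * d i) ∧ (∀ i, ∀ y ∈ B i, y ⬝ᵥ y = xB - β * d i) ∧
          (∀ i, ∀ z ∈ C i, z ⬝ᵥ z = xC + γ * d i)) ∧
        ((∀ i k, ∀ a ∈ A i, ∀ c ∈ C i, ∀ a' ∈ A k, ∀ c' ∈ C k, c - a = c' - a' → i = k ∧ a = a' ∧ c = c') ∧
         (∀ i k, ∀ a ∈ A i, ∀ b ∈ B i, ∀ a' ∈ A k, ∀ b' ∈ B k, b - a = b' - a' → i = k ∧ a = a' ∧ b = b') ∧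
         (∀ i k, ∀ b ∈ B i, ∀ c ∈ C i, ∀ b' ∈ B k, ∀ c' ∈ C k, b - c = b' - c' → i = k ∧ b = b' ∧ c = c') ∧
         (∀ i j k : Fin L, i ≠ j → j ≠ k → i ≠ k → 2 * d k ≤ d i + d j →
            ∀ s ∈ A k, ∀ s' ∈ A i, ∀ t ∈ B i, ∀ t' ∈ B j, ∀ u ∈ C j, ∀ u' ∈ C k,
              (s' - s) + (t' - t) + (u' - u) ≠ 0)) ∧
        (∀ i, (A i).card = N ∧ (B i).card = M ∧ (C i).card = N) ∧ 2 ≤ N ∧ (N : ℝ) ^ a ≤ M ∧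
        (∀ i, (∀ v ∈ A i, ∀ t, |v t| ≤ (b : ℤ)) ∧ (∀ v ∈ B i, ∀ t, |v t| ≤ (b : ℤ)) ∧
          (∀ v ∈ C i, ∀ t, |v t| ≤ (b : ℤ))) ∧
        (∀ i, |d i| ≤ (R : ℤ)) ∧
        (((6 * b + 1 : ℕ) : ℝ)) ^ D ≤ L * (N : ℝ) ^ (2 + η)) :
    ThinPackings := by
  refine thinPackings_of_weightedThinPackings ?_
  intro a ha0 ha1 η hη
  obtain ⟨D, L, N, M, b, R, A, B, C, d, xA, xB, xC, α, β, γ, hsl, hfr, hsph, hres, hc, hN, hM, hbox, hR,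
    hcount⟩ := hF a ha0 ha1 η hη
  have hLW : IsLabelWeightedSTPP A B C (fun i => -d i) (fun i => -d i) :=
    (stub_gradedFrames D L A B C d xA xB xC α β γ hsl hfr hsph).2 hres
  obtain ⟨hLW', hc'⟩ :=
    stub_boxFreiman D L b (6 * b + 1) A B C (fun i => -d i) (fun i => -d i) (by omega) hbox hLW
  refine ⟨Fin D → ZMod (6 * b + 1), inferInstance, inferInstance, L, N, M, R,
    fun i => (A i).image (fun (v : Fin D → ℤ) (t : Fin D) => (v t : ZMod (6 * b + 1))),
    fun i => (B i).image (fun (v : Fin D → ℤ) (t : Fin D) => (v t : ZMod (6 * b + 1))),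
    fun i => (C i).image (fun (v : Fin D → ℤ) (t : Fin D) => (v t : ZMod (6 * b + 1))),
    fun i => -d i, fun i => -d i, hLW', ?_, hN, hM, ?_, ?_⟩
  · intro i
    obtain ⟨h1, h2, h3⟩ := hc' i
    obtain ⟨g1, g2, g3⟩ := hc i
    exact ⟨h1.trans g1, h2.trans g2, h3.trans g3⟩
  · intro i
    have h := hR i
    simp only [abs_neg]
    exact ⟨h, h⟩
  · rw [Fintype.card_fun, Fintype.card_fin, ZMod.card]
    push_cast at hcount ⊢
    exact hcount

/-- **The line's composition, reshape v3** (`GeneralFrameDesigns → ThinPackings`): the registered design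
statement `stub_generalFrameDesigns` — orthogonal frames on spheres of ARBITRARY per-block squared radii
`rA i, rB i, rC i` in the box `[-b, b]^D`, ORDER-COMPATIBLE integer potentials `κ, μ` (`E k < E i ⇒ κ k + 1 ≤ κ i`,
`F k < F i ⇒ μ k + 1 ≤ μ i`, `T i < T k ⇒ κ k + μ k + 1 ≤ κ i + μ i` for `E = rA + rB`, `F = rB + rC`, `T = rA + rC`)
bounded by `R`, the three packings and the distinct clause on the triples of non-positive weight, blocks
`⟨N, M, N⟩` with `N ≥ 2`, `N^a ≤ M`, and `(6b+1)^D ≤ L·N^{2+η}` — implies the crux (`stub_generalBridge`,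
`stub_boxFreiman`, de-bordering). [new] -/
theorem thinPackings_of_generalFrameDesigns :
    (∀ a : ℝ, 0 ≤ a → a < 1 → ∀ η : ℝ, 0 < η →
      ∃ (D L N M b R : ℕ) (A B C : Fin L → Finset (Fin D → ℤ)) (rA rB rC κ μ : Fin L → ℤ),
        ((∀ i, ∀ x ∈ A i, ∀ y ∈ B i, x ⬝ᵥ y = 0) ∧ (∀ i, ∀ x ∈ A i, ∀ z ∈ C i, x ⬝ᵥ z = 0) ∧
          (∀ i, ∀ y ∈ B i, ∀ z ∈ C i, y ⬝ᵥ z = 0)) ∧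
        ((∀ i, ∀ x ∈ A i, x ⬝ᵥ x = rA i) ∧ (∀ i, ∀ y ∈ B i, y ⬝ᵥ y = rB i) ∧
          (∀ i, ∀ z ∈ C i, z ⬝ᵥ z = rC i)) ∧
        ((∀ i k, rA k + rB k < rA i + rB i → κ k + 1 ≤ κ i) ∧
          (∀ i k, rB k + rC k < rB i + rC i → μ k + 1 ≤ μ i) ∧
          (∀ i k, rA i + rC i < rA k + rC k → κ k + μ k + 1 ≤ κ i + μ i)) ∧
        ((∀ i k, ∀ a ∈ A i, ∀ c ∈ C i, ∀ a' ∈ A k, ∀ c' ∈ C k, c - a = c' - a' → i = k ∧ a = a' ∧ c = c') ∧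
         (∀ i k, ∀ a ∈ A i, ∀ b ∈ B i, ∀ a' ∈ A k, ∀ b' ∈ B k, b - a = b' - a' → i = k ∧ a = a' ∧ b = b') ∧
         (∀ i k, ∀ b ∈ B i, ∀ c ∈ C i, ∀ b' ∈ B k, ∀ c' ∈ C k, b - c = b' - c' → i = k ∧ b = b' ∧ c = c') ∧
         (∀ i j k : Fin L, i ≠ j → j ≠ k → i ≠ k → (κ i - κ k) + (μ j - μ k) ≤ 0 →
            ∀ s ∈ A k, ∀ s' ∈ A i, ∀ t ∈ B i, ∀ t' ∈ B j, ∀ u ∈ C j, ∀ u' ∈ C k,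
              (s' - s) + (t' - t) + (u' - u) ≠ 0)) ∧
        (∀ i, (A i).card = N ∧ (B i).card = M ∧ (C i).card = N) ∧ 2 ≤ N ∧ (N : ℝ) ^ a ≤ M ∧
        (∀ i, (∀ v ∈ A i, ∀ t, |v t| ≤ (b : ℤ)) ∧ (∀ v ∈ B i, ∀ t, |v t| ≤ (b : ℤ)) ∧
          (∀ v ∈ C i, ∀ t, |v t| ≤ (b : ℤ))) ∧
        (∀ i, |κ i| ≤ (R : ℤ) ∧ |μ i| ≤ (R : ℤ)) ∧
        (((6 * b + 1 : ℕ) : ℝ)) ^ D ≤ L * (N : ℝ) ^ (2 + η)) →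
    ThinPackings := by
  intro hF
  refine thinPackings_of_weightedThinPackings ?_
  intro a ha0 ha1 η hη
  obtain ⟨D, L, N, M, b, R, A, B, C, rA, rB, rC, κ, μ, hfr, hsph, hoc, hres, hc, hN, hM, hbox, hR,
    hcount⟩ := hF a ha0 ha1 η hη
  have hLW : IsLabelWeightedSTPP A B C κ μ :=
    (stub_generalBridge D L A B C rA rB rC κ μ hfr hsph hoc).2 hres
  obtain ⟨hLW', hc'⟩ := stub_boxFreiman D L b (6 * b + 1) A B C κ μ (by omega) hbox hLW
  refine ⟨Fin D → ZMod (6 * b + 1), inferInstance, inferInstance, L, N, M, R,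
    fun i => (A i).image (fun (v : Fin D → ℤ) (t : Fin D) => (v t : ZMod (6 * b + 1))),
    fun i => (B i).image (fun (v : Fin D → ℤ) (t : Fin D) => (v t : ZMod (6 * b + 1))),
    fun i => (C i).image (fun (v : Fin D → ℤ) (t : Fin D) => (v t : ZMod (6 * b + 1))),
    κ, μ, hLW', ?_, hN, hM, hR, ?_⟩
  · intro i
    obtain ⟨h1, h2, h3⟩ := hc' i
    obtain ⟨g1, g2, g3⟩ := hc i
    exact ⟨h1.trans g1, h2.trans g2, h3.trans g3⟩
  · rw [Fintype.card_fun, Fintype.card_fin, ZMod.card]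
    push_cast at hcount ⊢
    exact hcount

end Summit.MatrixMultiplication.MatrixMultiplication.Theorems.ThinPackings
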